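import Mathlib
import Summits.Ventures.PercRepro2.Defs
import Summits.Ventures.PercRepro2.Graph
import Summits.Ventures.PercRepro2.HullDefs
import Summits.Ventures.PercRepro2.LocRows
import Summits.Ventures.PercRepro2.SwRow

/-!
# Row (SW) on paths (blind cell PercRepro2, night-4 g5, 2026-08-24; proofs/NIGHT4-BRIDGE.md)

The path `p 0 – p 1 – ⋯ – p k` (`pathEnds p`, `p` injective) with `l = p 0`, `h = p k` and
`o = p j` (`0 < j < k`).  The red cluster of `p 0` is an initial segment (`mem_cluster_zero_iff`) and
the red cluster of `p k` a final segment (`mem_cluster_last_iff`), so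
`Q = {h ∉ H_l, o ∈ R_side(l)} = {edges before o red} ∩ {some edge blue}`, and the permutation
`swapTail` — keep the red `l`–`o` segment, swap the `o`–`h` segment unless it is all blue — is a
permutation of `Q` turning the red cluster of `h` (a final segment) into a blue final segment of the
same length (`sw_path`).  With the bridge lemma `Glue2.sw_glue2` (SwGlue2.lean) this gives row (SW) on
every gluing of such a path with an arbitrary second side at `{l, h}` — the cycles `C_n` in particular
(`Path2.sw_path_glue2`, SwCycle.lean).
-/

namespace Summit.Ventures.PercRepro2

namespace Path2

open Hull LocRows

open scoped Classical

variable {V : Type*} {k : ℕ}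

/-- The incidence map of the path `p 0 – p 1 – ⋯ – p k`. -/
def pathEnds (p : Fin (k + 1) → V) : Fin k → Sym2 V := fun i => s(p i.castSucc, p i.succ)

/-- All edges before the vertex `v` are red. -/
def RedPrefix (ζ : Config (Fin k)) (v : Fin (k + 1)) : Prop := ∀ i : Fin k, (i : ℕ) < v → ζ i = true

/-- All edges from the vertex `v` on are red. -/
def RedSuffix (ζ : Config (Fin k)) (v : Fin (k + 1)) : Prop := ∀ i : Fin k, (v : ℕ) ≤ i → ζ i = true

variable {p : Fin (k + 1) → V}

/-- An open edge of the path joins consecutive vertices. -/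
lemma adj_path_iff {ζ : Config (Fin k)} {x y : V} :
    (openGraph (pathEnds p) ζ).Adj x y →
      ∃ i : Fin k, ζ i = true ∧ ((x = p i.castSucc ∧ y = p i.succ) ∨ (x = p i.succ ∧ y = p i.castSucc)) := by
  intro hxy
  obtain ⟨_, i, hi, hends⟩ := openGraph_adj.1 hxy
  refine ⟨i, hi, ?_⟩
  simp only [pathEnds] at hends
  rcases Sym2.eq_iff.1 hends with ⟨h₁, h₂⟩ | ⟨h₁, h₂⟩
  · exact Or.inl ⟨h₁.symm, h₂.symm⟩
  · exact Or.inr ⟨h₂.symm, h₁.symm⟩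

/-- The red cluster of `p 0` is the initial segment of red edges. -/
theorem mem_cluster_zero_iff (hp : Function.Injective p) (ζ : Config (Fin k)) (x : V) :
    x ∈ cluster (pathEnds p) ζ (p 0) ↔ ∃ v, x = p v ∧ RedPrefix ζ v := by
  constructor
  · intro hx
    refine mem_of_conn_of_closed (ends := pathEnds p) (ω := ζ)
      (S := {x | ∃ v, x = p v ∧ RedPrefix ζ v}) ?_ ⟨0, rfl, fun i hi => by simp at hi⟩ hx
    rintro x ⟨v, rfl, hv⟩ y hxy
    obtain ⟨i, hi, ⟨h₁, h₂⟩ | ⟨h₁, h₂⟩⟩ := adj_path_iff hxy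
    · -- `v = i`, `y = p (i+1)`
      have hvi : v = i.castSucc := hp h₁
      refine ⟨i.succ, h₂, fun i' hi' => ?_⟩
      rw [Fin.val_succ] at hi'
      rcases Nat.lt_succ_iff_lt_or_eq.1 hi' with h | h
      · exact hv i' (by rw [hvi, Fin.val_castSucc]; exact h)
      · rw [Fin.ext h]; exact hi
    · -- `v = i+1`, `y = p i`
      have hvi : v = i.succ := hp h₁
      refine ⟨i.castSucc, h₂, fun i' hi' => ?_⟩
      exact hv i' (by rw [hvi, Fin.val_succ]; rw [Fin.val_castSucc] at hi'; omega)
  · rintro ⟨v, rfl, hv⟩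
    -- induction on `v`
    induction v using Fin.induction with
    | zero => exact mem_cluster_self _ _ _
    | succ i ih =>
      have hi : ζ i = true := hv i (by rw [Fin.val_succ]; omega)
      have hprev : RedPrefix ζ i.castSucc := fun i' hi' =>
        hv i' (by rw [Fin.val_succ]; rw [Fin.val_castSucc] at hi'; omega)
      exact mem_cluster_of_edge (ends := pathEnds p) (ih hprev) (e := i) hi rfl

/-- The red cluster of `p k` is the final segment of red edges. -/
theorem mem_cluster_last_iff (hp : Function.Injective p) (ζ : Config (Fin k)) (x : V) :
    x ∈ cluster (pathEnds p) ζ (p (Fin.last k)) ↔ ∃ v, x = p v ∧ RedSuffix ζ v := by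
  constructor
  · intro hx
    refine mem_of_conn_of_closed (ends := pathEnds p) (ω := ζ)
      (S := {x | ∃ v, x = p v ∧ RedSuffix ζ v}) ?_
      ⟨Fin.last k, rfl, fun i hi => by simp [Fin.val_last] at hi; omega⟩ hx
    rintro x ⟨v, rfl, hv⟩ y hxy
    obtain ⟨i, hi, ⟨h₁, h₂⟩ | ⟨h₁, h₂⟩⟩ := adj_path_iff hxy
    · -- `v = i`, `y = p (i+1)`
      have hvi : v = i.castSucc := hp h₁
      refine ⟨i.succ, h₂, fun i' hi' => ?_⟩
      exact hv i' (by rw [hvi, Fin.val_castSucc]; rw [Fin.val_succ] at hi'; omega)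
    · -- `v = i+1`, `y = p i`
      have hvi : v = i.succ := hp h₁
      refine ⟨i.castSucc, h₂, fun i' hi' => ?_⟩
      rw [Fin.val_castSucc] at hi'
      rcases Nat.eq_or_lt_of_le hi' with h | h
      · rw [← Fin.ext h]; exact hi
      · exact hv i' (by rw [hvi, Fin.val_succ]; omega)
  · rintro ⟨v, rfl, hv⟩
    -- reverse induction on `v`
    induction v using Fin.reverseInduction with
    | last => exact mem_cluster_self _ _ _
    | cast i ih =>
      have hi : ζ i = true := hv i (by rw [Fin.val_castSucc])
      have hnext : RedSuffix ζ i.succ := fun i' hi' =>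
        hv i' (by rw [Fin.val_castSucc]; rw [Fin.val_succ] at hi'; omega)
      exact mem_cluster_of_edge (ends := pathEnds p) (ih hnext) (e := i) hi
        (by rw [pathEnds, Sym2.eq_swap])

/-- `p v` is in the red cluster of `p 0` iff the edges before `v` are red. -/
lemma p_mem_cluster_zero_iff (hp : Function.Injective p) (ζ : Config (Fin k)) (v : Fin (k + 1)) :
    p v ∈ cluster (pathEnds p) ζ (p 0) ↔ RedPrefix ζ v := by
  rw [mem_cluster_zero_iff hp]
  constructor
  · rintro ⟨w, hw, hpre⟩
    rw [hp hw]; exact hpre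
  · intro hpre; exact ⟨v, rfl, hpre⟩

/-- `p v` is in the red cluster of `p k` iff the edges from `v` on are red. -/
lemma p_mem_cluster_last_iff (hp : Function.Injective p) (ζ : Config (Fin k)) (v : Fin (k + 1)) :
    p v ∈ cluster (pathEnds p) ζ (p (Fin.last k)) ↔ RedSuffix ζ v := by
  rw [mem_cluster_last_iff hp]
  constructor
  · rintro ⟨w, hw, hsuf⟩
    rw [hp hw]; exact hsuf
  · intro hsuf; exact ⟨v, rfl, hsuf⟩

/-- **`Q` on the path**: the edges before `o = p j` are red and some edge is blue. -/
theorem mem_tgtU_path_iff (hp : Function.Injective p) {j : Fin (k + 1)} (hj : 0 < (j : ℕ))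
    (ζ : Config (Fin k)) :
    ζ ∈ tgtU (pathEnds p) (p 0) (p (Fin.last k)) {S : Set V | p j ∈ S} ↔
      RedPrefix ζ j ∧ ∃ i, ζ i = false := by
  simp only [tgtU, Finset.mem_filter, Finset.mem_univ, true_and, hull, Set.mem_union,
    Set.mem_setOf_eq, not_or, p_mem_cluster_zero_iff hp]
  constructor
  · rintro ⟨⟨hA, _⟩, hoA, _⟩
    refine ⟨hoA, ?_⟩
    by_contra hcon
    push Not at hcon
    exact hA fun i _ => by simpa using hcon i
  · rintro ⟨hpre, i, hi⟩
    have hk : 0 < k := lt_of_lt_of_le hj (Nat.lt_succ_iff.1 j.isLt)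
    have h0 : ζ ⟨0, hk⟩ = true := hpre ⟨0, hk⟩ hj
    refine ⟨⟨?_, ?_⟩, hpre, ?_⟩
    · intro hall
      have := hall i (by rw [Fin.val_last]; exact i.isLt)
      rw [hi] at this; exact Bool.false_ne_true this
    · intro hall
      have := hall ⟨0, hk⟩ (by simp [Fin.val_last]; exact hk)
      simp [blue, h0] at this
    · intro hall
      have := hall ⟨0, hk⟩ hj
      simp [blue, h0] at this

/-- The permutation of `Q`: keep the edges before `j`, swap the edges from `j` on unless they are all
blue. -/
noncomputable def swapTail (j : Fin (k + 1)) (ζ : Config (Fin k)) : Config (Fin k) :=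
  if ∀ i : Fin k, (j : ℕ) ≤ i → ζ i = false then ζ else fun i => if (i : ℕ) < j then ζ i else !ζ i

/-- The edges before `j` are kept. -/
lemma swapTail_of_lt (j : Fin (k + 1)) (ζ : Config (Fin k)) {i : Fin k} (hi : (i : ℕ) < j) :
    swapTail j ζ i = ζ i := by
  unfold swapTail
  split_ifs with h <;> simp [hi]

/-- In the mixed case the edges from `j` on are swapped. -/
lemma swapTail_of_le (j : Fin (k + 1)) (ζ : Config (Fin k))
    (hmix : ¬ ∀ i : Fin k, (j : ℕ) ≤ i → ζ i = false) {i : Fin k} (hi : (j : ℕ) ≤ i) :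
    swapTail j ζ i = !ζ i := by
  unfold swapTail
  rw [if_neg hmix]
  simp [Nat.not_lt.2 hi]

/-- In the all-blue case the configuration is kept. -/
lemma swapTail_of_allBlue (j : Fin (k + 1)) (ζ : Config (Fin k))
    (hall : ∀ i : Fin k, (j : ℕ) ≤ i → ζ i = false) : swapTail j ζ = ζ := by
  unfold swapTail
  rw [if_pos hall]

/-- `swapTail` maps `Q` to `Q`. -/
lemma swapTail_mem (hp : Function.Injective p) {j : Fin (k + 1)} (hj : 0 < (j : ℕ))
    {ζ : Config (Fin k)}
    (hζ : ζ ∈ tgtU (pathEnds p) (p 0) (p (Fin.last k)) {S : Set V | p j ∈ S}) :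
    swapTail j ζ ∈ tgtU (pathEnds p) (p 0) (p (Fin.last k)) {S : Set V | p j ∈ S} := by
  rw [mem_tgtU_path_iff hp hj] at hζ ⊢
  obtain ⟨hpre, i, hi⟩ := hζ
  by_cases hall : ∀ i : Fin k, (j : ℕ) ≤ i → ζ i = false
  · rw [swapTail_of_allBlue j ζ hall]; exact ⟨hpre, i, hi⟩
  · refine ⟨fun i' hi' => by rw [swapTail_of_lt j ζ hi']; exact hpre i' hi', ?_⟩
    push Not at hall
    obtain ⟨i', hi', hred⟩ := hall
    refine ⟨i', ?_⟩
    rw [swapTail_of_le j ζ (by push Not; exact ⟨i', hi', hred⟩) hi']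
    simp [hred]

/-- `swapTail` is injective on `Q`. -/
lemma swapTail_injOn (hp : Function.Injective p) {j : Fin (k + 1)} (hj : 0 < (j : ℕ))
    {ζ ζ' : Config (Fin k)}
    (hζ : ζ ∈ tgtU (pathEnds p) (p 0) (p (Fin.last k)) {S : Set V | p j ∈ S})
    (hζ' : ζ' ∈ tgtU (pathEnds p) (p 0) (p (Fin.last k)) {S : Set V | p j ∈ S})
    (heq : swapTail j ζ = swapTail j ζ') : ζ = ζ' := by
  rw [mem_tgtU_path_iff hp hj] at hζ hζ'
  by_cases hall : ∀ i : Fin k, (j : ℕ) ≤ i → ζ i = false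
  · by_cases hall' : ∀ i : Fin k, (j : ℕ) ≤ i → ζ' i = false
    · rwa [swapTail_of_allBlue j ζ hall, swapTail_of_allBlue j ζ' hall'] at heq
    · -- `ζ` all blue after `j`, `ζ'` mixed: then `ζ'` is all red after `j`, contradicting `Q`
      exfalso
      obtain ⟨i, hi⟩ := hζ'.2
      have hij : (j : ℕ) ≤ i := by
        by_contra hlt; push Not at hlt
        have := hζ'.1 i hlt; rw [hi] at this; exact Bool.false_ne_true this
      have h1 := congrFun heq i
      rw [swapTail_of_allBlue j ζ hall, swapTail_of_le j ζ' hall' hij, hall i hij, hi] at h1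
      simp at h1
  · by_cases hall' : ∀ i : Fin k, (j : ℕ) ≤ i → ζ' i = false
    · exfalso
      obtain ⟨i, hi⟩ := hζ.2
      have hij : (j : ℕ) ≤ i := by
        by_contra hlt; push Not at hlt
        have := hζ.1 i hlt; rw [hi] at this; exact Bool.false_ne_true this
      have h1 := congrFun heq i
      rw [swapTail_of_allBlue j ζ' hall', swapTail_of_le j ζ hall hij, hall' i hij, hi] at h1
      simp at h1
    · funext i
      have h1 := congrFun heq i
      by_cases hi : (i : ℕ) < j
      · rwa [swapTail_of_lt j ζ hi, swapTail_of_lt j ζ' hi] at h1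
      · push Not at hi
        rw [swapTail_of_le j ζ hall hi, swapTail_of_le j ζ' hall' hi] at h1
        simpa using h1

/-- The red cluster of `h` is carried into the blue cluster of `h` of the image. -/
lemma cluster_subset_swapTail (hp : Function.Injective p) {j : Fin (k + 1)} (hj : 0 < (j : ℕ))
    {ζ : Config (Fin k)}
    (hζ : ζ ∈ tgtU (pathEnds p) (p 0) (p (Fin.last k)) {S : Set V | p j ∈ S}) :
    cluster (pathEnds p) ζ (p (Fin.last k)) ⊆
      cluster (pathEnds p) (blue (swapTail j ζ)) (p (Fin.last k)) := by
  rw [mem_tgtU_path_iff hp hj] at hζ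
  intro x hx
  rw [mem_cluster_last_iff hp] at hx ⊢
  obtain ⟨v, rfl, hsuf⟩ := hx
  refine ⟨v, rfl, fun i hi => ?_⟩
  -- every red edge from `v` on lies at or after `j`
  have hjv : (j : ℕ) ≤ v := by
    by_contra hlt; push Not at hlt
    obtain ⟨i', hi'⟩ := hζ.2
    by_cases hi'j : (i' : ℕ) < j
    · have := hζ.1 i' hi'j; rw [hi'] at this; exact Bool.false_ne_true this
    · push Not at hi'j
      have := hsuf i' (by omega); rw [hi'] at this; exact Bool.false_ne_true this
  by_cases hall : ∀ i : Fin k, (j : ℕ) ≤ i → ζ i = false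
  · -- all blue from `j` on: the red suffix from `v` is empty
    exfalso
    have := hall i (by omega)
    rw [hsuf i hi] at this
    exact Bool.true_eq_false ▸ this
  · rw [blue_eq_true_iff, swapTail_of_le j ζ hall (by omega), hsuf i hi]
    rfl

variable (p) in
/-- **Row (SW) on a path** with `l = p 0`, `h = p k` and `o = p j` interior. -/
theorem sw_path (hp : Function.Injective p) {j : Fin (k + 1)} (hj : 0 < (j : ℕ)) :
    Sw (pathEnds p) (p 0) (p (Fin.last k)) (p j) := by
  refine ⟨fun x => swapTail j x.1, ?_, fun x => ⟨swapTail_mem hp hj x.2, cluster_subset_swapTail hp hj x.2⟩⟩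
  intro x y hxy
  exact Subtype.ext (swapTail_injOn hp hj x.2 y.2 hxy)

end Path2

end Summit.Ventures.PercRepro2
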